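import Mathlib
import HarnessLib
import Summits.Ventures.LatticeQCDFlow.Exactness.SU2StapleSum

/-!
# Cabibbo–Marinari: the SU(2)-subgroup hit of an SU(N) link sees only the quaternionic projection of its 2 × 2 block

HONEST FRAMING: exact (Metropolis-corrected) sampling algorithms for lattice gauge theory;
figures of merit are autocorrelation/cost numbers at stated couplings and volumes; no
continuum-physics claim.

Venture `LatticeQCDFlow` (cell pub-lqcd), topic `Exactness`, FANOUT row 9 (eng-latcore; the
engine's SU(N) heat bath / over-relaxation `csrc/latcore_template.c`: for each SU(2) subgroup
`(i, j)` it reads the 2 × 2 block `w` of `W = U R` (`R` the staple sum), forms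
`a₀ = Re(w₀₀ + w₁₁)/2, …` — the quaternionic projection — and runs the `N = 2` kernel with that
"staple").  NEW WORK of the cell (matrix algebra over Mathlib and `SU2StapleSum.lean`); nothing is
cited as a fact.  Printed counterparts, named only: Cabibbo–Marinari 1982, Okawa 1982.

`SU2StapleSum.lean` and `WilsonOverrelaxation.lean` close the `N = 2` story and list `N ≥ 3` as
"Not here: there the staple sum is not a multiple of a unitary; Cabibbo–Marinari applies the
`N = 2` statement inside each SU(2) subgroup".  This file supplies the two algebraic facts that make
that reduction exact, and `SubgroupHeatBath.lean` the measure-theoretic one (the subgroup heat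
bath on a group with invariant measure is reversible):

## Content

* `quatOf a b = [[a, b], [−b̄, ā]]`, `quatDouble w = quatOf (w₀₀ + w̄₁₁) (w₀₁ − w̄₁₀)` — TWICE the
  quaternionic projection of a 2 × 2 complex matrix; `isQuat_quatDouble`, and
  **`IsQuat.two_mul_re_trace_mul`**: for every quaternion `A` (every SU(2) matrix,
  `IsQuat.of_mem_specialUnitaryGroup`) and every `w`, `2 Re tr (A w) = Re tr (A · quatDouble w)` —
  the SU(2) hit sees only the projection, which IS `k ŝ` (`IsQuat.exists_eq_smul_specialUnitary`).
* `blockEmb e A` — the 2 × 2 matrix `A` placed in the block singled out by `e : n ≃ Fin 2 ⊕ m`,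
  identity elsewhere; `blockEmb_mul/_one/_conjTranspose`, `det_blockEmb`,
  `blockEmb_mem_specialUnitaryGroup`, the monoid hom **`blockEmbSU e : SU(2) →* SU(n)`**,
  `continuous_blockEmb`, `measurable_blockEmbSU` (the `φ` of `SubgroupHeatBath.lean`).
* **`re_trace_blockEmb_mul`** — `Re tr (blockEmb e A · W) = Re tr (A · W₁₁) + Re tr W₂₂` with
  `W₁₁`, `W₂₂` the diagonal blocks of `W` in the frame `e`.
* **`cabibboMarinari_weight`** — hence the one-link Wilson weight along the subgroup factorises:
  `exp (c Re tr (blockEmb e A · U · R)) = exp ((c/2) Re tr (A · quatDouble (U R)₁₁)) · exp (c Re tr (U R)₂₂)`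
  — the law induced on the SU(2) subgroup is the `N = 2` link law with quaternionic staple
  `quatDouble (U R)₁₁ = k ŝ`, times a factor independent of `A`.

Not here: the sweep over the `N(N−1)/2` subgroups (composition of invariant kernels,
`InvariantComposition.lean`), the SU(2) sampler itself (`RejectionSampling.lean`; a₀ marginal untyped).
-/

namespace Summit.Ventures.LatticeQCDFlow.Exactness

open Matrix ComplexConjugate

/-! ## §1 The quaternionic projection -/

/-- The quaternion `[[a, b], [−b̄, ā]]`. -/
def quatOf (a b : ℂ) : Matrix (Fin 2) (Fin 2) ℂ := !![a, b; -conj b, conj a]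

/-- `quatOf a b` is a quaternion. -/
theorem isQuat_quatOf (a b : ℂ) : IsQuat (quatOf a b) :=
  ⟨by simp [quatOf], by simp [quatOf]⟩

/-- Twice the quaternionic projection of a `2 × 2` complex matrix:
`quatDouble w = quatOf (w₀₀ + conj w₁₁) (w₀₁ − conj w₁₀)` (the engine's `2 (a₀ + i a⃗·σ⃗)` read off `w`). -/
def quatDouble (w : Matrix (Fin 2) (Fin 2) ℂ) : Matrix (Fin 2) (Fin 2) ℂ :=
  quatOf (w 0 0 + conj (w 1 1)) (w 0 1 - conj (w 1 0))

/-- The projection is a quaternion (hence `k ŝ`, `IsQuat.exists_eq_smul_specialUnitary`). -/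
theorem isQuat_quatDouble (w : Matrix (Fin 2) (Fin 2) ℂ) : IsQuat (quatDouble w) :=
  isQuat_quatOf _ _

/-- On quaternions the projection is twice the identity. -/
theorem quatDouble_of_isQuat {w : Matrix (Fin 2) (Fin 2) ℂ} (hw : IsQuat w) :
    quatDouble w = (2 : ℂ) • w := by
  ext i j
  fin_cases i <;> fin_cases j <;>
    simp [quatDouble, quatOf, hw.diag, hw.offdiag, two_mul]

/-- **A quaternion sees only the quaternionic projection**: for `A` a quaternion (in particular
`A ∈ SU(2)`) and any `2 × 2` complex `w`, `2 Re tr (A w) = Re tr (A · quatDouble w)`. -/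
theorem IsQuat.two_mul_re_trace_mul {A : Matrix (Fin 2) (Fin 2) ℂ} (hA : IsQuat A)
    (w : Matrix (Fin 2) (Fin 2) ℂ) :
    2 * ((A * w).trace).re = ((A * quatDouble w).trace).re := by
  simp only [Matrix.trace_fin_two, Matrix.mul_apply, Fin.sum_univ_two, quatDouble, quatOf,
    hA.diag, hA.offdiag, Matrix.of_apply, Matrix.cons_val', Matrix.cons_val_zero,
    Matrix.cons_val_one, Matrix.empty_val', Matrix.cons_val_fin_one,
    Complex.add_re, Complex.mul_re, Complex.neg_re, Complex.neg_im, Complex.conj_re,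
    Complex.conj_im, Complex.sub_re, Complex.sub_im, Complex.add_im]
  ring

/-! ## §2 The block embedding `SU(2) → SU(n)` -/

section Block

variable {n m : Type*} [Fintype n] [DecidableEq n] [Fintype m] [DecidableEq m]
  (e : n ≃ Fin 2 ⊕ m)

/-- `A` placed in the `2 × 2` block singled out by the frame `e`, identity on the complement. -/
def blockEmb (A : Matrix (Fin 2) (Fin 2) ℂ) : Matrix n n ℂ :=
  (Matrix.fromBlocks A 0 0 (1 : Matrix m m ℂ)).submatrix e e

omit [DecidableEq n] in
/-- The embedding is multiplicative. -/
theorem blockEmb_mul (A B : Matrix (Fin 2) (Fin 2) ℂ) :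
    blockEmb e (A * B) = blockEmb e A * blockEmb e B := by
  unfold blockEmb
  rw [Matrix.submatrix_mul_equiv, Matrix.fromBlocks_multiply]
  simp

omit [Fintype n] [Fintype m] in
/-- The embedding sends `1` to `1`. -/
theorem blockEmb_one : blockEmb e (1 : Matrix (Fin 2) (Fin 2) ℂ) = 1 := by
  unfold blockEmb
  rw [Matrix.fromBlocks_one, Matrix.submatrix_one_equiv]

omit [Fintype n] [DecidableEq n] [Fintype m] in
/-- The embedding commutes with the conjugate transpose. -/
theorem blockEmb_conjTranspose (A : Matrix (Fin 2) (Fin 2) ℂ) :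
    (blockEmb e A)ᴴ = blockEmb e Aᴴ := by
  unfold blockEmb
  rw [Matrix.conjTranspose_submatrix, Matrix.fromBlocks_conjTranspose]
  simp

/-- `det (blockEmb e A) = det A`. -/
theorem det_blockEmb (A : Matrix (Fin 2) (Fin 2) ℂ) : (blockEmb e A).det = A.det := by
  unfold blockEmb
  rw [Matrix.det_submatrix_equiv_self, Matrix.det_fromBlocks_zero₂₁, Matrix.det_one, mul_one]

/-- The embedding maps SU(2) into SU(n). -/
theorem blockEmb_mem_specialUnitaryGroup {A : Matrix (Fin 2) (Fin 2) ℂ}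
    (hA : A ∈ Matrix.specialUnitaryGroup (Fin 2) ℂ) :
    blockEmb e A ∈ Matrix.specialUnitaryGroup n ℂ := by
  rw [Matrix.mem_specialUnitaryGroup_iff] at hA ⊢
  refine ⟨?_, ?_⟩
  · rw [Matrix.mem_unitaryGroup_iff, Matrix.star_eq_conjTranspose, blockEmb_conjTranspose,
      ← blockEmb_mul, ← Matrix.star_eq_conjTranspose, Matrix.mem_unitaryGroup_iff.mp hA.1,
      blockEmb_one]
  · rw [det_blockEmb, hA.2]

/-- **The block embedding as a group homomorphism `SU(2) →* SU(n)`** (the `φ` of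
`SubgroupHeatBath.lean` for the Cabibbo–Marinari hit). -/
def blockEmbSU : Matrix.specialUnitaryGroup (Fin 2) ℂ →* Matrix.specialUnitaryGroup n ℂ where
  toFun A := ⟨blockEmb e A, blockEmb_mem_specialUnitaryGroup e A.2⟩
  map_one' := Subtype.ext (by simp [blockEmb_one])
  map_mul' A B := Subtype.ext (by simp [blockEmb_mul])

/-- Underlying matrix of the embedded element. -/
@[simp] theorem coe_blockEmbSU (A : Matrix.specialUnitaryGroup (Fin 2) ℂ) :
    (↑(blockEmbSU e A) : Matrix n n ℂ) = blockEmb e A := rfl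

omit [Fintype n] [DecidableEq n] [Fintype m] in
/-- The embedding is continuous … -/
theorem continuous_blockEmb : Continuous (blockEmb e : Matrix (Fin 2) (Fin 2) ℂ → Matrix n n ℂ) :=
  (Continuous.matrix_fromBlocks continuous_id continuous_const continuous_const
    continuous_const).matrix_submatrix e e

/-- … hence the homomorphism is measurable (Borel structures of `GaugeGroups.lean`). -/
theorem measurable_blockEmbSU : Measurable (blockEmbSU e) :=
  (Continuous.subtype_mk ((continuous_blockEmb e).comp continuous_subtype_val) _).measurable

/-! ## §3 The subgroup sees the block -/

omit [DecidableEq n] [DecidableEq m] in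
/-- `tr (M.submatrix e e) = tr M` for an equivalence `e`. -/
theorem trace_submatrix_equiv' (M : Matrix (Fin 2 ⊕ m) (Fin 2 ⊕ m) ℂ) :
    (M.submatrix e e).trace = M.trace := by
  simp only [Matrix.trace, Matrix.diag, Matrix.submatrix_apply]
  exact e.sum_comp (fun i => M i i)

omit [Fintype n] [DecidableEq n] [DecidableEq m] in
/-- `tr (fromBlocks A B C D) = tr A + tr D`. -/
theorem trace_fromBlocks' (A : Matrix (Fin 2) (Fin 2) ℂ) (B : Matrix (Fin 2) m ℂ)
    (C : Matrix m (Fin 2) ℂ) (D : Matrix m m ℂ) :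
    (Matrix.fromBlocks A B C D).trace = A.trace + D.trace := by
  simp [Matrix.trace, Fintype.sum_sum_type]

omit [DecidableEq n] in
/-- **`Re tr (blockEmb e A · W) = Re tr (A · W₁₁) + Re tr W₂₂`**, where `W₁₁`, `W₂₂` are the diagonal
blocks of `W` in the frame `e` (`(W.submatrix e.symm e.symm).toBlocks`). -/
theorem re_trace_blockEmb_mul (A : Matrix (Fin 2) (Fin 2) ℂ) (W : Matrix n n ℂ) :
    ((blockEmb e A * W).trace).re
      = ((A * (W.submatrix e.symm e.symm).toBlocks₁₁).trace).re
        + (((W.submatrix e.symm e.symm).toBlocks₂₂).trace).re := by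
  set W' := W.submatrix e.symm e.symm with hW'
  have hW : W = W'.submatrix e e := by
    rw [hW', Matrix.submatrix_submatrix]
    simp
  conv_lhs => rw [hW, blockEmb, Matrix.submatrix_mul_equiv, trace_submatrix_equiv',
    ← Matrix.fromBlocks_toBlocks W', Matrix.fromBlocks_multiply]
  simp only [Matrix.zero_mul, add_zero, Matrix.one_mul, zero_add, trace_fromBlocks',
    Complex.add_re]

/-! ## §4 The Cabibbo–Marinari weight along the subgroup -/

omit [DecidableEq n] in
/-- **The induced law on the SU(2) subgroup is the `N = 2` link law with quaternionic staple.**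
For a quaternion `A` (every SU(2) matrix), every frame `e`, link `U`, staple sum `R` and real `c`
(`c = β/N`): with `W = U R` and `W₁₁`, `W₂₂` its diagonal blocks in the frame,
`exp (c Re tr (blockEmb e A · U · R)) = exp ((c/2) Re tr (A · quatDouble W₁₁)) · exp (c Re tr W₂₂)`;
the second factor does not depend on `A`, and `quatDouble W₁₁` is a quaternion, i.e. `k ŝ` with
`ŝ ∈ SU(2)` (`IsQuat.exists_eq_smul_specialUnitary`). -/
theorem cabibboMarinari_weight {A : Matrix (Fin 2) (Fin 2) ℂ} (hA : IsQuat A) (c : ℝ)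
    (U R : Matrix n n ℂ) :
    Real.exp (c * ((blockEmb e A * U * R).trace).re)
      = Real.exp (c / 2 * ((A * quatDouble ((U * R).submatrix e.symm e.symm).toBlocks₁₁).trace).re)
        * Real.exp (c * ((((U * R).submatrix e.symm e.symm).toBlocks₂₂).trace).re) := by
  rw [← Real.exp_add, Matrix.mul_assoc, re_trace_blockEmb_mul, ← hA.two_mul_re_trace_mul]
  ring_nf

end Block

end Summit.Ventures.LatticeQCDFlow.Exactness
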